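import Summits.Ventures.PercRepro.PuncturedLYMTwoCoHypGenMain
import Summits.Ventures.PercRepro.PuncturedLYMTwoCoHypTheorem
import Summits.Ventures.PercRepro.PuncturedLYMTwoCoHypGenPosR

/-!
# PercRepro — TWO CO-HYPERPLANES OF ANY INTERSECTION, PART 7: THE THEOREM — (SP) FOR `upLevel j C₁ ∪ upLevel j C₂`
(p10, gen 35)

* `card_punctured_union_upLevel'` — `#P + C(n − m₁, j − m₁) + C(n − m₂, j − m₂) = C(n, j)` whenever `#(C₁ ∪ C₂) ≥ j + 2`;
* **`puncturedNMP_union_upLevel'`** — **the `j`-sets containing neither of two sets `C₁, C₂` with `#C_i ≤ j`,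
  `#(C₁ ∖ C₂), #(C₂ ∖ C₁) ≥ 2` and `#(C₁ ∪ C₂) ≥ j + 2` have the normalised matching property against the level
  above, for every `2j + 1 ≤ n`** — the equal-split flow of parts 3–6 on `A = C₁ ∖ C₂`, `B = C₂ ∖ C₁`, `S = C₁ ∩ C₂`
  through the master lemma `puncturedNMP_gen_of_seq`.  (The disjoint case is `puncturedNMP_union_upLevel`.)
Nothing here asserts (SP), (PAV) or (NC) in general.
-/

namespace PercRepro.PuncturedLYM

open Finset

variable {α : Type} [Fintype α] [DecidableEq α]

/-- No `j`-set contains both `C₁` and `C₂` when `#(C₁ ∪ C₂) ≥ j + 2`. -/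
theorem disjoint_upLevel_of_big' {j : ℕ} {C₁ C₂ : Finset α} (hbig : j + 2 ≤ (C₁ ∪ C₂).card) :
    Disjoint (upLevel j C₁) (upLevel j C₂) := by
  rw [disjoint_left]
  intro X h1 h2
  rw [mem_upLevel] at h1 h2
  have := card_le_card (union_subset h1.2 h2.2)
  rw [h1.1] at this
  omega

/-- **`#P + C(n − m₁, j − m₁) + C(n − m₂, j − m₂) = C(n, j)`** for `upLevel j C₁ ∪ upLevel j C₂`, `#(C₁ ∪ C₂) ≥ j + 2`. -/
theorem card_punctured_union_upLevel' {j : ℕ} {C₁ C₂ : Finset α} (hm₁j : C₁.card ≤ j) (hm₂j : C₂.card ≤ j)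
    (hbig : j + 2 ≤ (C₁ ∪ C₂).card) :
    (punctured j (upLevel j C₁ ∪ upLevel j C₂)).card + (Fintype.card α - C₁.card).choose (j - C₁.card) +
      (Fintype.card α - C₂.card).choose (j - C₂.card) = (Fintype.card α).choose j := by
  unfold punctured
  have hsub : upLevel j C₁ ∪ upLevel j C₂ ⊆ (univ : Finset α).powersetCard j := by
    intro X hX
    rw [mem_union, mem_upLevel, mem_upLevel] at hX
    rw [mem_powersetCard]
    rcases hX with h | h <;> exact ⟨subset_univ X, h.1⟩
  have h := card_sdiff_add_card_eq_card hsub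
  rw [card_union_of_disjoint (disjoint_upLevel_of_big' hbig), card_upLevel hm₁j, card_upLevel hm₂j,
    card_powersetCard, card_univ] at h
  omega

/-- **THE THEOREM: (SP) for the `j`-sets containing neither of two sets `C₁, C₂`** with `#C₁, #C₂ ≤ j`,
`#(C₁ ∖ C₂) ≥ 2`, `#(C₂ ∖ C₁) ≥ 2`, `#(C₁ ∪ C₂) ≥ j + 2` and `2j + 1 ≤ n`. -/
theorem puncturedNMP_union_upLevel' {j : ℕ} {C₁ C₂ : Finset α} (hm₁j : C₁.card ≤ j) (hm₂j : C₂.card ≤ j)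
    (hA : 2 ≤ (C₁ \ C₂).card) (hB : 2 ≤ (C₂ \ C₁).card) (hbig : j + 2 ≤ (C₁ ∪ C₂).card)
    (hn : 2 * j + 1 ≤ Fintype.card α) : PuncturedNMP j (upLevel j C₁ ∪ upLevel j C₂) := by
  set n := Fintype.card α with hn_def
  set m₁ := C₁.card with hm₁_def
  set m₂ := C₂.card with hm₂_def
  set s := (C₁ ∩ C₂).card with hs_def
  -- the three pieces
  have hC₁ : (C₁ \ C₂) ∪ (C₁ ∩ C₂) = C₁ := sdiff_union_inter C₁ C₂
  have hC₂ : (C₂ \ C₁) ∪ (C₁ ∩ C₂) = C₂ := by rw [inter_comm]; exact sdiff_union_inter C₂ C₁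
  have hAS : Disjoint (C₁ \ C₂) (C₁ ∩ C₂) := disjoint_sdiff_inter C₁ C₂
  have hBS : Disjoint (C₂ \ C₁) (C₁ ∩ C₂) := by rw [inter_comm]; exact disjoint_sdiff_inter C₂ C₁
  have hAB : Disjoint (C₁ \ C₂) (C₂ \ C₁) := by
    rw [disjoint_left]
    intro z h1 h2
    exact (mem_sdiff.1 h1).2 (mem_sdiff.1 h2).1
  have hcA : (C₁ \ C₂).card = m₁ - s := by
    have := card_sdiff_add_card_inter C₁ C₂
    omega
  have hcB : (C₂ \ C₁).card = m₂ - s := by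
    have := card_sdiff_add_card_inter C₂ C₁
    rw [inter_comm] at this
    omega
  have hcU : (C₁ ∪ C₂).card = m₁ + m₂ - s := by
    have := card_union_add_card_inter C₁ C₂
    omega
  have hs₁ : s + 2 ≤ m₁ := by omega
  have hs₂ : s + 2 ≤ m₂ := by omega
  have hbig' : j + 2 ≤ m₁ + m₂ - s := by omega
  have hjn : j < n := by omega
  have key : PuncturedNMP j (upLevel j ((C₁ \ C₂) ∪ (C₁ ∩ C₂)) ∪ upLevel j ((C₂ \ C₁) ∪ (C₁ ∩ C₂))) := by
    apply puncturedNMP_gen_of_seq hjn hAB hAS hBS (by rw [hcA, hcB]; omega) (w3A n j m₁ m₂ s) (w3B n j m₁ m₂ s)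
      (w3D n j m₁ m₂ s) (w3R n j m₁ m₂ s) (twoK n j m₁ m₂)
    · -- `twoK · #Y = #P`
      rw [hC₁, hC₂]
      have hY : (levelAbove α j).card = n.choose (j + 1) := by
        unfold levelAbove
        rw [card_powersetCard, card_univ]
      have hP := card_punctured_union_upLevel' hm₁j hm₂j hbig
      have hPq : ((punctured j (upLevel j C₁ ∪ upLevel j C₂)).card : ℚ) =
          (n.choose j : ℚ) - ((n - m₁).choose (j - m₁) : ℕ) - ((n - m₂).choose (j - m₂) : ℕ) := by
        have : ((punctured j (upLevel j C₁ ∪ upLevel j C₂)).card : ℚ) + ((n - m₁).choose (j - m₁) : ℕ) +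
            ((n - m₂).choose (j - m₂) : ℕ) = (n.choose j : ℚ) := by exact_mod_cast hP
        linarith
      rw [hY, hPq]
      have hYpos : (0 : ℚ) < (n.choose (j + 1) : ℕ) := by exact_mod_cast Nat.choose_pos (by omega)
      have hr : (0 : ℚ) < ((n - j : ℕ) : ℚ) := by
        have : 1 ≤ n - j := by omega
        exact_mod_cast this
      have hch := choose_succ_mul_eq n j
      unfold twoK coK coP
      field_simp
      linear_combination (-1 : ℚ) * hch
    · intro a b d ha hb hd h1 h2
      simp only [hcA, hcB, ← hs_def] at ha hb hd h1 h2 ⊢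
      exact w3_nonneg (s := s) hm₁j hm₂j hs₁ hs₂ hbig' hn a b d ha hb hd h1 h2
    · intro a b d ha hb hd h1 h2 hab _
      simp only [hcA, hcB, ← hs_def] at ha hb hd h1 h2 hab ⊢
      exact w3_row (s := s) (by omega) hm₁j (by omega) hm₂j (by omega) (by omega) hbig' hn a b d ha hb hd h1 h2 hab
    · intro a' b' d' ha hb hd h1 h2 hab _
      simp only [hcA, hcB, ← hs_def] at ha hb hd h1 h2 hab ⊢
      exact w3_col (s := s) (by omega) hm₁j (by omega) hm₂j hs₁ hs₂ hbig' hn a' b' d' ha hb hd h1 h2 hab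
    · intro b' hb _ _
      simp only [hcA, hcB, ← hs_def] at hb ⊢
      exact w3_top₁ (s := s) (by omega) (by omega) b' hb
    · intro a' ha _ _
      simp only [hcA, hcB, ← hs_def] at ha ⊢
      exact w3_top₂ (s := s) (by omega) (by omega) a' ha
  rwa [hC₁, hC₂] at key

end PercRepro.PuncturedLYM
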